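import Literature.AlgebraicGeometry.Resolution.RsopMonomialIdeals
import Mathlib.RingTheory.AdjoinRoot
import Mathlib.RingTheory.Ideal.Colon
import HarnessLib

/-!
# [OURS · L1 W4.2] D18 (G8): SATURATION ARITHMETIC in a frame ring `R'[X]/(h)` — the stalks of the transformed boundary members
# `⋃ₙ ((c·w) : cⁿ) = (w)`, `⋃ₙ ((w) : cⁿ) = (w)` for distinct frame parameters `c, w`
# (cell res-hironaka, LADDER-RESOLUTION rung L; slot W4.2, crux chain w42 `SigmaMaxModificationsCorridor3` stmt-ResolutionOfSingularities-19249;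
# `--supports stmt-ResolutionOfSingularities-19249 --as helper`; res-L1-w42-plan-1 RULING v3.14-42 part 2 (KG)(2) «(G8) E-adapted propagation»;
# hand res-D-brk-3 (gen 7), file F2c-alg of DESIGN 17:06:09Z)

PURE COMMUTATIVE ALGEBRA, 0 `def`s, every declaration PROVED; OURS bookkeeping; NOT a statement of Hironaka's manuscript [Hironaka2017] nor of
[CossartJannsenSaito2020]/[CossartPiltant2019]. AI-written, weaker than expert review.

WHY. The stalk at `x'` of the strict transform of an old boundary member `V(K)` is the saturation `⋃ₙ (K·𝒪_{x'} : 𝓘(D)ⁿ)` by the exceptional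
ideal (tree `stalkIdeal_strictTransformIdeal`); read in the propagated CP frame `R'[X]/(h')` through the flat presentation (`Ideal.map_colon_of_flat`)
it is `⋃ₙ ((c·w) : cⁿ)` with `c = u'_{j₀}` the exceptional parameter and `w = u'_j` (a member containing the centre) — or `⋃ₙ ((w) : cⁿ)` (a member
transversal to the centre). Both equal `(w)` because distinct members of an r.s.p. of `R'` stay «regular modulo each other» in `R'[X]/(h')`
(`R'[X]/(h', w) = (R'/w)[X]/(h̄')` is free over the domain `R'/(w)`).

* `iSup_colon_span_singleton_pow_eq_of_forall_mem`, `iSup_colon_span_singleton_mul_pow_eq` — the two saturations, abstractly.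
* `mem_span_C_of_C_mul_mem_span_C` — in `R'[X]/(h)` (`h` monic, `R'` local, `u` part of an r.s.p., `i ≠ j`): `ū_i·b ∈ (ū_j) ⇒ b ∈ (ū_j)`;
  `mk_C_mem_nonZeroDivisors` — `ū_i` is a non-zero-divisor of `R'[X]/(h)`.

References: Matsumura Thms. 14.2–14.3 (r.s.p. primes), 17.8 [Matsumura1987]; Görtz–Wedhorn I (13.19) [GortzWedhorn2020].
-/

noncomputable section

set_option linter.dupNamespace false

open IsLocalRing Polynomial
open Literature.AlgebraicGeometry.Resolution

universe u

namespace Summit.ResolutionOfSingularities.ResolutionOfSingularities.Theorems.SigmaMaxModificationsCorridor3.Helpers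

section Saturation

variable {B : Type u} [CommRing B]

/-- If `c` is regular modulo `(w)` then so is every power `cⁿ`. [folklore] -/
theorem mem_span_singleton_of_pow_mul_mem {c w : B} (hreg : ∀ b, c * b ∈ Ideal.span {w} → b ∈ Ideal.span {w}) (n : ℕ) {b : B}
    (hb : c ^ n * b ∈ Ideal.span {w}) : b ∈ Ideal.span {w} := by
  induction n generalizing b with
  | zero => simpa using hb
  | succ n ih =>
    apply ih
    apply hreg
    rw [pow_succ, mul_assoc] at hb
    rwa [mul_left_comm] at hb

/-- **`⋃ₙ ((w) : cⁿ) = (w)`** when `c` is regular modulo `(w)` (a member transversal to the centre). [folklore] -/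
theorem iSup_colon_span_singleton_pow_eq_of_forall_mem {c w : B} (hreg : ∀ b, c * b ∈ Ideal.span {w} → b ∈ Ideal.span {w}) :
    (⨆ n : ℕ, (Ideal.span {w}).colon ((Ideal.span {c} ^ n : Ideal B) : Set B)) = Ideal.span {w} := by
  apply le_antisymm
  · refine iSup_le fun n => fun b hb => ?_
    rw [Submodule.mem_colon] at hb
    have h1 : b * c ^ n ∈ Ideal.span {w} := by
      have := hb (c ^ n) (by rw [Ideal.span_singleton_pow]; exact Ideal.mem_span_singleton_self _)
      simpa [smul_eq_mul] using this
    rw [mul_comm] at h1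
    exact mem_span_singleton_of_pow_mul_mem hreg n h1
  · refine le_trans ?_ (le_iSup _ 0)
    intro b hb
    rw [Submodule.mem_colon]
    intro s _
    rw [smul_eq_mul]
    exact Ideal.mul_mem_right _ _ hb

/-- **`⋃ₙ ((c·w) : cⁿ) = (w)`** when `c` is a non-zero-divisor regular modulo `(w)` (a member containing the centre: its total transform
`(c·w)` saturates to the strict transform `(w)`). [cite: GortzWedhorn2020, (13.19) p. 414] -/
theorem iSup_colon_span_singleton_mul_pow_eq {c w : B} (hreg : ∀ b, c * b ∈ Ideal.span {w} → b ∈ Ideal.span {w})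
    (hc : c ∈ nonZeroDivisors B) :
    (⨆ n : ℕ, (Ideal.span {c * w}).colon ((Ideal.span {c} ^ n : Ideal B) : Set B)) = Ideal.span {w} := by
  apply le_antisymm
  · refine iSup_le fun n => fun b hb => ?_
    rw [Submodule.mem_colon] at hb
    have h1 : b * c ^ n ∈ Ideal.span {c * w} := by
      have := hb (c ^ n) (by rw [Ideal.span_singleton_pow]; exact Ideal.mem_span_singleton_self _)
      simpa [smul_eq_mul] using this
    rcases n with _ | n
    · rw [pow_zero, mul_one] at h1
      exact Ideal.span_singleton_le_span_singleton.mpr (dvd_mul_left w c) h1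
    · obtain ⟨d, hd⟩ := Ideal.mem_span_singleton'.mp h1
      have h2 : c * (c ^ n * b - d * w) = 0 := by
        rw [mul_sub, ← mul_assoc, ← pow_succ', mul_comm (c ^ (n + 1)) b, ← hd]
        ring
      have h3 : c ^ n * b - d * w = 0 := by
        rw [mul_comm] at h2
        exact (mul_right_mem_nonZeroDivisors_eq_zero_iff hc).mp h2
      exact mem_span_singleton_of_pow_mul_mem hreg n (by rw [sub_eq_zero.mp h3]; exact Ideal.mem_span_singleton'.mpr ⟨d, rfl⟩)
  · refine le_trans ?_ (le_iSup _ 1)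
    intro b hb
    rw [Submodule.mem_colon]
    intro s hs
    rw [pow_one] at hs
    obtain ⟨d, rfl⟩ := Ideal.mem_span_singleton'.mp hs
    obtain ⟨e, rfl⟩ := Ideal.mem_span_singleton'.mp hb
    rw [smul_eq_mul]
    exact Ideal.mem_span_singleton'.mpr ⟨e * d, by ring⟩

end Saturation

/-! ## Frame parameters stay regular modulo each other in `R[X]/(h)` -/

section Frame

/-- Over a domain `D`, if `h̄ ∣ C c · q` with `h̄` monic and `c ≠ 0` then `h̄ ∣ q`. [folklore] -/
theorem dvd_of_dvd_C_mul_of_ne_zero {D : Type u} [CommRing D] [IsDomain D] {g : D[X]} (hg : g.Monic) {c : D} (hc : c ≠ 0) {q : D[X]}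
    (hdvd : g ∣ C c * q) : g ∣ q := by
  rw [← Polynomial.modByMonic_eq_zero_iff_dvd hg] at hdvd ⊢
  have h1 : C c * (q %ₘ g) = 0 := by
    rw [← Polynomial.smul_eq_C_mul, ← Polynomial.smul_modByMonic, Polynomial.smul_eq_C_mul, hdvd]
  rcases mul_eq_zero.mp h1 with h2 | h2
  · exact absurd (Polynomial.C_eq_zero.mp h2) hc
  · exact h2

/-- In `R[X]/(h)` with `h` monic over a domain `R`, a non-zero constant `c ∈ R` is a non-zero-divisor. [folklore] -/
theorem mk_C_mem_nonZeroDivisors_of_ne_zero {R : Type u} [CommRing R] [IsDomain R] {h : R[X]} (hmo : h.Monic) {c : R} (hc : c ≠ 0) :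
    Ideal.Quotient.mk (Ideal.span {h}) (C c) ∈ nonZeroDivisors (R[X] ⧸ Ideal.span {h}) := by
  rw [mem_nonZeroDivisors_iff_right]
  intro b hb
  obtain ⟨q, rfl⟩ := Ideal.Quotient.mk_surjective b
  rw [← map_mul, Ideal.Quotient.eq_zero_iff_mem, Ideal.mem_span_singleton, mul_comm] at hb
  rw [Ideal.Quotient.eq_zero_iff_mem, Ideal.mem_span_singleton]
  exact dvd_of_dvd_C_mul_of_ne_zero hmo hc hb

/-- The reduction `R[X]/(h) → (R/(w))[X]/(h̄)` kills exactly `(w̄)`: if `q̄ ↦ 0` then `q̄ ∈ (w̄)`. [folklore] -/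
theorem mem_span_mk_C_of_map_eq_zero {R : Type u} [CommRing R] {h : R[X]} (w : R) {q : R[X]}
    (hq : Ideal.Quotient.mk (Ideal.span {h.map (Ideal.Quotient.mk (Ideal.span {w}))}) (q.map (Ideal.Quotient.mk (Ideal.span {w}))) = 0) :
    Ideal.Quotient.mk (Ideal.span {h}) q ∈ Ideal.span {Ideal.Quotient.mk (Ideal.span {h}) (C w)} := by
  rw [Ideal.Quotient.eq_zero_iff_mem, Ideal.mem_span_singleton'] at hq
  obtain ⟨r, hr⟩ := hq
  obtain ⟨r, rfl⟩ := Polynomial.map_surjective (Ideal.Quotient.mk (Ideal.span {w})) Ideal.Quotient.mk_surjective r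
  have h1 : q - r * h ∈ (Ideal.span {w}).map (C : R →+* R[X]) := by
    rw [← Ideal.mk_ker (I := Ideal.span {w}), ← Polynomial.ker_mapRingHom, RingHom.mem_ker, Polynomial.coe_mapRingHom,
      Polynomial.map_sub, Polynomial.map_mul, hr, sub_self]
  rw [Ideal.map_span, Set.image_singleton] at h1
  obtain ⟨t, ht⟩ := Ideal.mem_span_singleton'.mp h1
  have h2 : q = t * C w + r * h := by rw [ht]; ring
  rw [h2, map_add, map_mul, map_mul, Ideal.Quotient.eq_zero_iff_mem.mpr (Ideal.mem_span_singleton_self h), mul_zero, add_zero]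
  exact Ideal.mul_mem_left _ _ (Ideal.mem_span_singleton_self _)

/-- **Distinct frame parameters are regular modulo each other in `R[X]/(h)`**: for `u` part of an r.s.p. of the local ring `R`, `h` monic and
`i ≠ j`, `ū_i·b ∈ (ū_j) ⇒ b ∈ (ū_j)` in `R[X]/(h)` (`R[X]/(h, u_j) = (R/u_j)[X]/(h̄)` is free over the domain `R/(u_j)` and `ū_i ≠ 0` there).
[cite: Matsumura1987, Thm. 14.3] -/
theorem mem_span_mk_C_of_mk_C_mul_mem {R : Type u} [CommRing R] [IsLocalRing R] {n : ℕ} {u : Fin n → R} (hz : IsRsopPart u)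
    {h : R[X]} (hmo : h.Monic) {i j : Fin n} (hij : i ≠ j) {b : R[X] ⧸ Ideal.span {h}}
    (hb : Ideal.Quotient.mk (Ideal.span {h}) (C (u i)) * b ∈ Ideal.span {Ideal.Quotient.mk (Ideal.span {h}) (C (u j))}) :
    b ∈ Ideal.span {Ideal.Quotient.mk (Ideal.span {h}) (C (u j))} := by
  classical
  set w := u j with hw
  haveI : (Ideal.span {w}).IsPrime := (Ideal.span_singleton_prime (hz.ne_zero j)).mpr (hz.prime j)
  haveI : IsDomain (R ⧸ Ideal.span {w}) := Ideal.Quotient.isDomain _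
  set mkD := Ideal.Quotient.mk (Ideal.span {w}) with hmkD
  have hmo' : (h.map mkD).Monic := hmo.map _
  have hui : mkD (u i) ≠ 0 := by
    intro h0
    rw [hmkD, Ideal.Quotient.eq_zero_iff_mem] at h0
    have := hz.not_mem_span_image (S := ({j} : Set (Fin n))) (i := i) (by simpa using hij)
    rw [Set.image_singleton] at this
    exact this h0
  obtain ⟨q, rfl⟩ := Ideal.Quotient.mk_surjective b
  obtain ⟨d, hd⟩ := Ideal.mem_span_singleton'.mp hb
  obtain ⟨t, rfl⟩ := Ideal.Quotient.mk_surjective d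
  -- `C u_i · q − t · C w ∈ (h)`
  rw [← map_mul, ← map_mul, Ideal.Quotient.eq, Ideal.mem_span_singleton] at hd
  obtain ⟨r, hr⟩ := hd
  -- reduce modulo `w`: `h̄ ∣ C ū_i · q̄`
  have h1 : h.map mkD ∣ C (mkD (u i)) * q.map mkD := by
    refine ⟨-(r.map mkD), ?_⟩
    have h2 := congrArg (Polynomial.map mkD) hr
    rw [Polynomial.map_sub, Polynomial.map_mul, Polynomial.map_mul, Polynomial.map_mul, Polynomial.map_C, Polynomial.map_C,
      show mkD w = 0 from Ideal.Quotient.eq_zero_iff_mem.mpr (Ideal.mem_span_singleton_self w), map_zero, mul_zero, zero_sub] at h2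
    rw [mul_neg, ← h2, neg_neg]
  have h3 : h.map mkD ∣ q.map mkD := dvd_of_dvd_C_mul_of_ne_zero hmo' hui h1
  apply mem_span_mk_C_of_map_eq_zero w
  rw [Ideal.Quotient.eq_zero_iff_mem, Ideal.mem_span_singleton]
  exact h3

end Frame

end Summit.ResolutionOfSingularities.ResolutionOfSingularities.Theorems.SigmaMaxModificationsCorridor3.Helpers

end
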